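import Literature.AnabelianGeometry.SemiGraphs.TreeSystemFixedPair
import HarnessLib

/-!
# Compatible systems of fixed vertices under the condition (∗_j) of the author's Comments (6)

Mochizuki, *Semi-graphs of anabelioids*, Publ. RIMS **42** (2006), proof of Theorem 3.7 (iii), manuscript
p. 41 [cite: MochizukiSemiAnbd2006, Thm 3.7(iii) p.41], in the form of the author's *Comments on
"Semi-graphs of Anabelioids"* (May 2020), item (6) (cell file HOME/lit/SemiAnbd-Comments-2020.txt):
"for `i ≥ j` … let us write `E_{j,i} ⊆ E_j` for the image of `E_i` in `E_j` [`E_i` = the closed edges of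
`𝒢_{i,∞}` fixed by `H`] … (∗_j) there exists an `i ∈ J` such that `i ≥ j` and `#E_{j,i} = 1` … the unique
elements of the `E_{j,∞}` form a compatible system of closed edges fixed by `H` … `H` is contained in
some edge-like subgroup, hence also in two distinct verticial subgroups … (c) If `H` is contained in
three distinct verticial subgroups, then … one obtains a contradiction to the condition (∗_j)".

This PROOF-ONLY file is the tree-system combinatorics of that replacement argument, for a directed system
of TREES `T j` with actions `ρ j : C →* Aut (T j)` and transition MORPHISMS `f : i ≤ j → (T j ⟶ T i)`,
under the hypothesis

  `hstar : ∀ j, ∃ i (h : j ≤ i), ∀ e e', e fixed → e' fixed → (f h).edgeMap e = (f h).edgeMap e'`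

("all `C`-fixed edges of `T i` have ONE image in `T j`" — the condition (∗_j); it replaces the hypothesis
"at most two fixed vertices at every large level" of `TreeSystemFixedPair`, cf. cell ruling θ2).  The one
new ingredient is `exists_edge_preimage_of_mem_support`: along a morphism `φ : T' ⟶ T` into a tree, every
edge of the geodesic of `T` between the images of two vertices is the image of an edge of any walk of `T'`
between them (the image walk, shortened to a path, IS the geodesic).  Results:

* `adjacent_of_image_fixed_edges_eq` — one transition `φ : T' ⟶ T`: two `C`-fixed vertices of `T'`
  with distinct images, all fixed edges of `T'` having one `φ`-image ⇒ the images are joined by a single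
  CLOSED edge of `T`, fixed with its branches, which is the image of a fixed edge of `T'`;
* `adjacent_of_hstar` — two compatible systems of fixed vertices differing somewhere are, at every higher
  level, joined by a single closed edge fixed with its branches (same conclusion as
  `adjacent_of_compatible_fixed_systems`);
* `atMostTwo_systems_of_hstar` — there are no three pairwise-different compatible systems of fixed
  vertices (same conclusion as `atMostTwo_compatible_fixed_systems`).
No definitions; nothing specific to anabelioids.
-/

namespace Literature.AnabelianGeometry.SemiGraphs

namespace SemiGraph

open CategoryTheory

universe w v u

/-! ### One morphism into a tree: edges of the target geodesic are images -/

section OneMorphism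

variable {G G' : SemiGraph.{u}}

/-- **Edges of the geodesic are images.**  Let `φ : G ⟶ G'` be a morphism into a semi-graph with
acyclic subdivision, `q` any walk of the subdivision of `G` from the vertex `a` to the vertex `b`, and
`p` the (unique) path of `G'` from `φ a` to `φ b`.  Then every edge-point on `p` is the image of an
edge-point on `q`: the image of `q`, shortened to a path, is `p`. [cite: MochizukiSemiAnbd2006, Thm 3.7(iii) p.41] -/
theorem exists_edge_preimage_of_mem_support (hG' : G'.subdivision.IsAcyclic) (φ : G ⟶ G')
    {a b : G.Vertex} (q : G.subdivision.Walk (Sum.inl a) (Sum.inl b))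
    (p : G'.subdivision.Walk (Sum.inl (φ.vertexMap a)) (Sum.inl (φ.vertexMap b))) (hp : p.IsPath)
    {ε : G'.Edge} (hε : Sum.inr (Sum.inl ε) ∈ p.support) :
    ∃ e : G.Edge, Sum.inr (Sum.inl e) ∈ q.support ∧ φ.edgeMap e = ε := by
  classical
  -- the node map of `φ`, a homomorphism of subdivisions
  let F : G.subdivision →g G'.subdivision :=
    ⟨Sum.map φ.vertexMap (Sum.map φ.edgeMap φ.branchMap), fun h => subdivision_adj_map φ h⟩
  let W : G'.subdivision.Walk (Sum.inl (φ.vertexMap a)) (Sum.inl (φ.vertexMap b)) := q.map F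
  -- its shortening to a path is the geodesic `p`
  have hWp : W.bypass = p := by
    have huniq := hG'.path_unique ⟨W.bypass, W.bypass_isPath⟩ ⟨p, hp⟩
    exact congrArg Subtype.val huniq
  have h1 : Sum.inr (Sum.inl ε) ∈ W.support := by
    apply W.support_bypass_subset_support
    rw [hWp]
    exact hε
  have h2 : Sum.inr (Sum.inl ε) ∈ q.support.map F := by
    rw [← SimpleGraph.Walk.support_map]
    exact h1
  obtain ⟨z, hz, hzε⟩ := List.mem_map.mp h2
  rcases z with v | e | br
  · exact absurd hzε (by simp [F])
  · refine ⟨e, hz, ?_⟩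
    simpa [F] using hzε
  · exact absurd hzε (by simp [F])

/-- **One transition step of (∗_j)** (Comments (6)(b),(c)): `φ : T' ⟶ T` a morphism of trees, a group
acting on both, `a`, `b` fixed vertices of `T'` whose images `φ a ≠ φ b` are fixed in `T`, and ALL fixed
edges of `T'` with ONE `φ`-image.  Then `φ a`, `φ b` are joined by a single CLOSED edge `ε` of `T`, fixed
together with its branches, and `ε` is the image of a fixed edge of `T'` (every edge of the geodesic
`φ a — φ b` is the image of an edge of the FIXED geodesic `a — b`, Lemma 1.8 (ii)(b), so there is only
one such edge). [cite: MochizukiSemiAnbd2006, Thm 3.7(iii) p.41] -/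
theorem adjacent_of_image_fixed_edges_eq {Γ : Type w} [Group Γ] {T' T : SemiGraph.{u}}
    (hT' : T'.IsTree) (hT : T.IsTree) (ρ' : Γ →* Aut T') (ρ : Γ →* Aut T) (φ : T' ⟶ T)
    {a b : T'.Vertex} (ha : ∀ γ, (ρ' γ).hom.vertexMap a = a) (hb : ∀ γ, (ρ' γ).hom.vertexMap b = b)
    (hφa : ∀ γ, (ρ γ).hom.vertexMap (φ.vertexMap a) = φ.vertexMap a)
    (hφb : ∀ γ, (ρ γ).hom.vertexMap (φ.vertexMap b) = φ.vertexMap b)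
    (hne : φ.vertexMap a ≠ φ.vertexMap b)
    (heq : ∀ e e' : T'.Edge, (∀ γ, (ρ' γ).hom.edgeMap e = e) → (∀ γ, (ρ' γ).hom.edgeMap e' = e') →
      φ.edgeMap e = φ.edgeMap e') :
    ∃ (ε : T.Edge) (c c' : T.Branch), T.IsClosedEdge ε ∧ c ≠ c' ∧ T.edgeOf c = ε ∧ T.edgeOf c' = ε ∧
      T.abuts c = some (φ.vertexMap a) ∧ T.abuts c' = some (φ.vertexMap b) ∧
      (∃ e : T'.Edge, (∀ γ, (ρ' γ).hom.edgeMap e = e) ∧ φ.edgeMap e = ε) ∧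
      ∀ γ, (ρ γ).hom.edgeMap ε = ε ∧ ∀ br : T.Branch, T.edgeOf br = ε → (ρ γ).hom.branchMap br = br := by
  have hA' : T'.subdivision.IsAcyclic := hT'.isTree.isAcyclic
  have hA : T.subdivision.IsAcyclic := hT.isTree.isAcyclic
  -- the fixed geodesic `a — b` of `T'`
  obtain ⟨q, hq⟩ := hT'.isTree.connected.exists_isPath (Sum.inl a) (Sum.inl b)
  have fixq : ∀ z ∈ q.support, ∀ γ, nodeMap (ρ' γ) z = z := fun z hz γ =>
    nodeMap_eq_self_of_isPath hA' (ρ' γ) (by simp [ha γ]) (by simp [hb γ]) q hq z hz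
  have fixqE : ∀ e : T'.Edge, Sum.inr (Sum.inl e) ∈ q.support → ∀ γ, (ρ' γ).hom.edgeMap e = e := by
    intro e he γ
    simpa using fixq _ he γ
  -- the fixed geodesic `φ a — φ b` of `T`
  obtain ⟨p, hp⟩ := hT.isTree.connected.exists_isPath (Sum.inl (φ.vertexMap a)) (Sum.inl (φ.vertexMap b))
  have fixp : ∀ z ∈ p.support, ∀ γ, nodeMap (ρ γ) z = z := fun z hz γ =>
    nodeMap_eq_self_of_isPath hA (ρ γ) (by simp [hφa γ]) (by simp [hφb γ]) p hp z hz
  rcases path_between_vertices_shape hne p hp with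
    ⟨v, e₁, e₂, c₁, c₂, hee, -, -, -, -, -, he₁s, he₂s⟩ | ⟨ε, c, c', hcc, hce, hc'e, hca, hc'b, hεs⟩
  · -- two distinct edges on the geodesic: both are images of fixed edges of `T'`, contradiction
    obtain ⟨e₁', he₁', rfl⟩ := exists_edge_preimage_of_mem_support hA φ q p hp he₁s
    obtain ⟨e₂', he₂', rfl⟩ := exists_edge_preimage_of_mem_support hA φ q p hp he₂s
    exact absurd (heq e₁' e₂' (fixqE e₁' he₁') (fixqE e₂' he₂')) hee
  · have hεfix : ∀ γ, (ρ γ).hom.edgeMap ε = ε := fun γ => by simpa using fixp _ hεs γ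
    obtain ⟨e, he, heε⟩ := exists_edge_preimage_of_mem_support hA φ q p hp hεs
    exact ⟨ε, c, c', isClosedEdge_of_abuts hcc hce hc'e hca hc'b, hcc, hce, hc'e, hca, hc'b,
      ⟨e, fixqE e he, heε⟩, fun γ =>
        ⟨hεfix γ, fun br hbr => branchMap_eq_self_of_fixed hA (ρ γ) hce hca (hφa γ) (hεfix γ) br hbr⟩⟩

end OneMorphism

/-! ### Systems of trees under (∗_j) -/

variable {J : Type v} [Preorder J] [IsDirectedOrder J] (T : J → SemiGraph.{u})
  {C : Type w} [Group C] (ρ : ∀ j, C →* Aut (T j)) (f : ∀ ⦃i j : J⦄, i ≤ j → (T j ⟶ T i))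

omit [IsDirectedOrder J] in
/-- **Two different compatible systems of fixed vertices are adjacent, under (∗_j)** (Comments (6)(b)):
if `x`, `y` are compatible systems of `C`-fixed vertices of the trees `T j` with `x i ≠ y i`, and all
fixed edges of some `T i'`, `i' ≥ j`, have one image in `T j`, then at every level `j ≥ i` the vertices
`x j ≠ y j` are joined by a single CLOSED edge, fixed by `C` together with all its branches.
[cite: MochizukiSemiAnbd2006, Thm 3.7(iii) p.41] -/
theorem adjacent_of_hstar (hT : ∀ j, (T j).IsTree)
    (hstar : ∀ j, ∃ (i : J) (h : j ≤ i), ∀ e e' : (T i).Edge, (∀ γ, (ρ i γ).hom.edgeMap e = e) →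
      (∀ γ, (ρ i γ).hom.edgeMap e' = e') → (f h).edgeMap e = (f h).edgeMap e')
    {x y : ∀ j, (T j).Vertex}
    (hx : ∀ ⦃i j : J⦄ (h : i ≤ j), (f h).vertexMap (x j) = x i)
    (hy : ∀ ⦃i j : J⦄ (h : i ≤ j), (f h).vertexMap (y j) = y i)
    (hxf : ∀ j γ, (ρ j γ).hom.vertexMap (x j) = x j) (hyf : ∀ j γ, (ρ j γ).hom.vertexMap (y j) = y j)
    {i : J} (hne : x i ≠ y i) {j : J} (hij : i ≤ j) :
    ∃ (e : (T j).Edge) (c c' : (T j).Branch), (T j).IsClosedEdge e ∧ c ≠ c' ∧ (T j).edgeOf c = e ∧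
      (T j).edgeOf c' = e ∧ (T j).abuts c = some (x j) ∧ (T j).abuts c' = some (y j) ∧
      ∀ γ, (ρ j γ).hom.edgeMap e = e ∧
        ∀ b : (T j).Branch, (T j).edgeOf b = e → (ρ j γ).hom.branchMap b = b := by
  have hxy : x j ≠ y j := ne_of_compatible_ne T (fun i j h => (f h).vertexMap) hx hy hne hij
  obtain ⟨i', h, heq⟩ := hstar j
  have hne' : (f h).vertexMap (x i') ≠ (f h).vertexMap (y i') := by rwa [hx h, hy h]
  obtain ⟨e, c, c', hcl, hcc, hce, hc'e, hca, hc'b, -, hfix⟩ :=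
    adjacent_of_image_fixed_edges_eq (hT i') (hT j) (ρ i') (ρ j) (f h) (hxf i') (hyf i')
      (by rw [hx h]; exact hxf j) (by rw [hy h]; exact hyf j) hne' heq
  rw [hx h] at hca
  rw [hy h] at hc'b
  exact ⟨e, c, c', hcl, hcc, hce, hc'e, hca, hc'b, hfix⟩

/-- **At most two compatible systems of fixed vertices, under (∗_j)** (Comments (6)(c)): there are no
three compatible systems of `C`-fixed vertices of the trees `T j` that are pairwise different somewhere
— at a level where all three differ, the three fixed geodesics between them map to ONE edge below,
which would have branches at three distinct vertices. [cite: MochizukiSemiAnbd2006, Thm 3.7(iii) p.41] -/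
theorem atMostTwo_systems_of_hstar (hT : ∀ j, (T j).IsTree)
    (hstar : ∀ j, ∃ (i : J) (h : j ≤ i), ∀ e e' : (T i).Edge, (∀ γ, (ρ i γ).hom.edgeMap e = e) →
      (∀ γ, (ρ i γ).hom.edgeMap e' = e') → (f h).edgeMap e = (f h).edgeMap e')
    {x y z : ∀ j, (T j).Vertex}
    (hx : ∀ ⦃i j : J⦄ (h : i ≤ j), (f h).vertexMap (x j) = x i)
    (hy : ∀ ⦃i j : J⦄ (h : i ≤ j), (f h).vertexMap (y j) = y i)
    (hz : ∀ ⦃i j : J⦄ (h : i ≤ j), (f h).vertexMap (z j) = z i)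
    (hxf : ∀ j γ, (ρ j γ).hom.vertexMap (x j) = x j) (hyf : ∀ j γ, (ρ j γ).hom.vertexMap (y j) = y j)
    (hzf : ∀ j γ, (ρ j γ).hom.vertexMap (z j) = z j)
    {i₁ i₂ i₃ : J} (h₁ : x i₁ ≠ y i₁) (h₂ : y i₂ ≠ z i₂) (h₃ : x i₃ ≠ z i₃) : False := by
  let π : ∀ ⦃i j : J⦄, i ≤ j → (T j).Vertex → (T i).Vertex := fun i j h => (f h).vertexMap
  -- a common upper bound of the witnesses, then a level of (∗_j) above it
  obtain ⟨k₁, hk₁, hk₂⟩ := exists_ge_ge i₁ i₂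
  obtain ⟨j, hj₁, hj₃⟩ := exists_ge_ge k₁ i₃
  obtain ⟨i, h, heq⟩ := hstar j
  have hxy : (f h).vertexMap (x i) ≠ (f h).vertexMap (y i) := by
    rw [hx h, hy h]; exact ne_of_compatible_ne T π hx hy h₁ (hk₁.trans hj₁)
  have hyz : (f h).vertexMap (y i) ≠ (f h).vertexMap (z i) := by
    rw [hy h, hz h]; exact ne_of_compatible_ne T π hy hz h₂ (hk₂.trans hj₁)
  have hxz : (f h).vertexMap (x i) ≠ (f h).vertexMap (z i) := by
    rw [hx h, hz h]; exact ne_of_compatible_ne T π hx hz h₃ hj₃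
  -- the three edges below, each the image of a fixed edge above, hence all equal
  obtain ⟨ε₁, c₁, c₁', -, hcc₁, hc₁, hc₁', hc₁a, hc₁'b, ⟨e₁, he₁, he₁ε⟩, -⟩ :=
    adjacent_of_image_fixed_edges_eq (hT i) (hT j) (ρ i) (ρ j) (f h) (hxf i) (hyf i)
      (by rw [hx h]; exact hxf j) (by rw [hy h]; exact hyf j) hxy heq
  obtain ⟨ε₂, c₂, c₂', -, -, -, hc₂', -, hc₂'b, ⟨e₂, he₂, he₂ε⟩, -⟩ :=
    adjacent_of_image_fixed_edges_eq (hT i) (hT j) (ρ i) (ρ j) (f h) (hyf i) (hzf i)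
      (by rw [hy h]; exact hyf j) (by rw [hz h]; exact hzf j) hyz heq
  have h12 : ε₁ = ε₂ := by rw [← he₁ε, ← he₂ε]; exact heq e₁ e₂ he₁ he₂
  -- `ε₁` has branches at the three distinct vertices `x j`, `y j`, `z j`
  have hd : (T j).edgeOf c₂' = ε₁ := by rw [h12]; exact hc₂'
  have hdc : c₂' ≠ c₁ := by
    intro hh; apply hxz; rw [← Option.some_inj, ← hc₁a, ← hc₂'b, hh]
  have hdc' : c₂' ≠ c₁' := by
    intro hh; apply hyz; rw [← Option.some_inj, ← hc₁'b, ← hc₂'b, hh]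
  exact hdc' (branch_eq_of_ne_of_ne hc₁ hd hc₁' hdc (Ne.symm hcc₁))

end SemiGraph

end Literature.AnabelianGeometry.SemiGraphs
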